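import Summits.CriticalPhenomena.PercolationContinuityZ3.Theses.PercNearOneGluing
import Literature.Probability.Percolation.PercolationProofs
import Literature.Probability.Percolation.ConditionalPositiveAssociationProofs
import Literature.Probability.Percolation.TwoClusterConditionalAssociationProofs

/-! TTRL-lite variant V1418 of stmt-CriticalPhenomena-4576 -/

namespace Summit.CriticalPhenomena.PercolationContinuityZ3.Theorems

open MeasureTheory Literature.Probability.LatticeModels Literature.Probability.Percolation
open scoped Classical BigOperators

/-- Pocket localisation (set identity, no measure): on the event `{C(o) = W}` with `a, b ∉ W`,
an open `a`–`b` path cannot touch `W` (else `a ∈ C(o) = W`), so `a ↔ b` iff `a ↔ b` inside `Wᶜ`.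
TTRL-lite variant V1418 of stmt-CriticalPhenomena-4576 (KN p.12, proof of Thm 4). -/
theorem additiveGluing_var1418 :
    ∀ (n : ℕ) (W : Finset (Fin n)) (o a b : Fin n), a ∉ W → b ∉ W →
      {ω : BondConfig (Fin n) | openCluster ω o = (W : Set (Fin n))} ∩ openConn a b
        = {ω : BondConfig (Fin n) | openCluster ω o = (W : Set (Fin n))}
          ∩ openConnIn ((W : Set (Fin n))ᶜ) a b := by
  intro n W o a b ha hb
  ext ω
  simp only [openConn, openConnIn, Set.mem_inter_iff, Set.mem_setOf_eq]
  constructor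
  · rintro ⟨hW, hab⟩
    refine ⟨hW, ?_⟩
    obtain ⟨q⟩ := hab
    have hs : ∀ y ∈ q.support, y ∈ ((W : Set (Fin n))ᶜ) := by
      intro y hy hyW
      have hoy : (openGraph ω).Reachable o y := by
        have hy' : y ∈ openCluster ω o := by rw [hW]; exact hyW
        exact hy'
      have hay : (openGraph ω).Reachable a y := ⟨q.takeUntil y hy⟩
      have hoa : a ∈ openCluster ω o := hoy.trans hay.symm
      rw [hW, Finset.mem_coe] at hoa
      exact ha hoa
    exact ⟨hs a q.start_mem_support, hs b q.end_mem_support, ⟨q.induce _ hs⟩⟩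
  · rintro ⟨hW, _, _, hr⟩
    exact ⟨hW, hr.map (SimpleGraph.Embedding.induce ((W : Set (Fin n))ᶜ)).toHom⟩

end Summit.CriticalPhenomena.PercolationContinuityZ3.Theorems
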